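import Summits.QuantumFields.YangMills.Theorems.BalabanUVNodesN06DirKinematicsAtPins
import Literature.MathematicalPhysics.QuantumFieldTheory.Balaban1983to89.B9WalkLettersCoordsS
import Literature.MathematicalPhysics.QuantumFieldTheory.Balaban1983to89.B9Thm31SiteGsqBoundsReg335Y
import Literature.MathematicalPhysics.QuantumFieldTheory.Balaban1983to89.B9OpsRTransport
import Literature.MathematicalPhysics.QuantumFieldTheory.Balaban1983to89.B9DirSupHolderAtPinsSN

/-!
# BalabanUVNodes ∕ N06 ([B9], `Dag.B9_main`) — THE NEAR-PAIR (SN) TWIN of `N06DirKinematics3AtPinsR.h36H_of_dir_pins₃R`: rows 18's kinematic conjuncts of `h36H` (`Gsq` transpose,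
# `DirTranspose37`, `DirSupHolder37`, `DirSup37` at the pins), R-generic over `bg9YR 𝔸 G R₁ R₂`, with the SITE HÖLDER PROBES re-pinned at dag-n06-c's NEAR-PAIR carrier
# `𝔭 x = holderProbesSN …` (`B9CoReadingCoordsHolderSNear`, p737775) instead of the same-block carrier `holderProbesSA`

Track A of `YM-PLAN.md` (cell `pub-ymgap`, D-0062), node **N06** = [Balaban1985BackgroundPropagators] Thms 3.1–3.15; seat `pub-ymgap-dag-n06-d` (gen 20).  WHY: dag-n06-c g19's
`HPDGW-ROAD.md` (located point = dag-n06-l g22 (i)): the G′-Hölder letters of rows 20–21 (`hpDGW`, `h43Gp`, …) live at cross-block (near-pair) probes, so deriving them from rows 18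
(`hpDGW_of_thm37PrintedSN`, p741263; `h43Gp_of_thm37PrintedSN`, p743190) needs rows 18's probe pin moved to the near-pair carrier — print's Hölder norms (3.41) p.397 ARE over near
pairs `|x − x′| ≤ 1`, so the near-pair pin is the print-literal one.  Of the certificate's three readers of the pin `h𝔭`, two have drop-in SN twins by dag-n06-c
(`site_h1ReadsNbr_of_pinsSN`, `site_inputReadsFam_of_pinsSN`); this file is the third: the proof is `h36H_of_dir_pins₃R`'s VERBATIM except that the `DirSupHolder37` conjunct
is read from dag-n06-c's B-generic `B9DirSupHolderAtPinsSN.dirSupHolder37_pinsSN` (p742100) directly at `bg9YR` (no `opsRY` transport for that conjunct); `dirTranspose37_memberY`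
and dag-n06-w5's `dirSup37_pins` are consumed exactly as before.
★★ `h36H_of_dir_pins₃SN` (+ `hGR`, `hY335`, as in the R twin).  HONEST FRAMING.  Mechanical re-pinning; kinematics only (no estimate of [B9]); COUNT-NEUTRAL; N06 NOT discharged;
K1⁹ NOT closed; one finite 𝕋⁴ programme at fixed `ε` — NOT continuum ∕ OS ∕ mass gap ∕ Clay.  0 `def`, 0 `sorry`.
-/

noncomputable section

namespace Summit.QuantumFields.YangMills.BalabanUVNodes.N06DirKinematics3AtPinsSN

open Literature.MathematicalPhysics.QuantumFieldTheory.Balaban1983to89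
open Literature.MathematicalPhysics.QuantumFieldTheory.Balaban1983to89.Node00 (SiteY FBondY IBondY SiteOpY SiteParY etaS parSymY)
open Literature.MathematicalPhysics.QuantumFieldTheory.Balaban1983to89.Node00.OpsYLocalInverse (GsqY)
open Literature.MathematicalPhysics.QuantumFieldTheory.Balaban1983to89.B6Cover236MultiLevelBlocks (cubes)
open Literature.MathematicalPhysics.QuantumFieldTheory.Balaban1983to89.Node00.OpsYDirTranspose (dirTranspose37_memberY)
open Literature.MathematicalPhysics.QuantumFieldTheory.Balaban1983to89.B9Thm37Whole (Ops)
open Literature.MathematicalPhysics.QuantumFieldTheory.Balaban1983to89.B9Thm37Glue (IsTransposePair)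
open Literature.MathematicalPhysics.QuantumFieldTheory.Balaban1983to89.B9RWSums346SecondDiffGp (DirOps37 DirTranspose37)
open Literature.MathematicalPhysics.QuantumFieldTheory.Balaban1983to89.B9RWSums346MixedPair (DirSup37)
open Literature.MathematicalPhysics.QuantumFieldTheory.Balaban1983to89.B9RWSums344InputPair (DirSupHolder37)
open Literature.MathematicalPhysics.QuantumFieldTheory.Balaban1983to89.B9RWSums343Holder (HolderProbes)
open Literature.MathematicalPhysics.QuantumFieldTheory.Balaban1983to89.B9CoReadingCoords (coordOpK)
open Literature.MathematicalPhysics.QuantumFieldTheory.Balaban1983to89.B9CoReadingCoordsS (XSK blkSK sIK GcoS DcoS DscoS)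
open Literature.MathematicalPhysics.QuantumFieldTheory.Balaban1983to89.B9CoReadingCoordsHolder (PK)
open Literature.MathematicalPhysics.QuantumFieldTheory.Balaban1983to89.B9CoReadingCoordsHolderSNear (holderProbesSN)
open Literature.MathematicalPhysics.QuantumFieldTheory.Balaban1983to89.B9DirSupHolderAtPinsSN (dirSupHolder37_pinsSN)
open Literature.MathematicalPhysics.QuantumFieldTheory.Balaban1983to89.B9CoReadingCoordsTranspose (TrIdx trBasis isTransposePair_GcoS_trBasis)
open Literature.MathematicalPhysics.QuantumFieldTheory.Balaban1983to89.B9Ineq349SiteComposite (cdSL cdsSL)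
open Literature.MathematicalPhysics.QuantumFieldTheory.Balaban1983to89.B9DirSupAtPins (dirSup37_pins)
open Literature.MathematicalPhysics.QuantumFieldTheory.Balaban1983to89.B9PinMembersKLevelV1 (MemberY geo9Y bg9Y)
open Literature.MathematicalPhysics.QuantumFieldTheory.Balaban1983to89.B9BackgroundsKLevelV1R (RegFamY bg9YR MemOfFam mem_of_reg335R)
open Literature.MathematicalPhysics.QuantumFieldTheory.Balaban1983to89.B9OpsRTransport (opsRY dirOps37RY dirTranspose37_iff dirSup37_iff)
open Literature.MathematicalPhysics.QuantumFieldTheory.Balaban1983to89.B7Prop2SpecialUnitary (specialUnitaryUnits specialUnitaryUnits_le_unitaryUnits)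
open Literature.MathematicalPhysics.QuantumFieldTheory.Balaban1983to89.B9WalkLettersCoordsS (gsqcoS cubeDomY)
open Literature.MathematicalPhysics.QuantumFieldTheory.Balaban1983to89.B9Thm31SiteGsqBoundsReg335Y (isSymmTr_GsqY_parSymY)
open scoped Matrix.Norms.L2Operator

variable {N : ℕ}
variable {d ℓ : ℕ} {hd : 1 ≤ d + 1} {hL : Odd (ℓ + 1) ∧ 1 < ℓ + 1} {b₀ b₁ : ℝ} {Mstar : ℕ}
variable [∀ x : MemberY d ℓ hd hL b₀ b₁ Mstar, Fintype (geo9Y x).Site]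

/-- ★★ **`h36H` WITH ITS KINEMATIC CONJUNCTS AT THE PINS, R-GENERIC, SITE PROBES AT THE NEAR-PAIR CARRIER `holderProbesSN`** (module docstring).
[cite: Balaban1985BackgroundPropagators, p.391 (transposes) + (3.8) p.392 + (3.42)–(3.45) pp.397–398 + (3.35)–(3.36) p.396 + Thm 3.11 p.416; Balaban1984PropagatorsII, (2.51) p.232] -/
theorem h36H_of_dir_pins₃SN {R₁ R₂ : RegFamY d ℓ hd hL b₀ b₁ Mstar (Matrix (Fin N) (Fin N) ℂ)} (hGR : MemOfFam (specialUnitaryUnits (Fin N)) R₁)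
    (𝔬 : ∀ x : MemberY d ℓ hd hL b₀ b₁ Mstar,
      Ops (geo9Y x) (bg9YR (Matrix (Fin N) (Fin N) ℂ) (specialUnitaryUnits (Fin N)) R₁ R₂ x) (XSK (TrIdx N) x.toKIdx) (XSK (TrIdx N) x.toKIdx)
        ↥(cubes x.toKIdx.D.toDomains))
    (𝔡 : ∀ x : MemberY d ℓ hd hL b₀ b₁ Mstar, DirOps37 (𝔬 x) (Fin (d + 1)))
    (𝔭 : ∀ x : MemberY d ℓ hd hL b₀ b₁ Mstar, HolderProbes (geo9Y x) (bg9YR (Matrix (Fin N) (Fin N) ℂ) (specialUnitaryUnits (Fin N)) R₁ R₂ x) (XSK (TrIdx N) x.toKIdx)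
      (XSK (TrIdx N) x.toKIdx) (PK (SiteY x.toKIdx) (Fin (d + 1)) (TrIdx N)) (PK (SiteY x.toKIdx) (Fin (d + 1)) (TrIdx N)))
    {bI : ∀ x : MemberY d ℓ hd hL b₀ b₁ Mstar, FBondY x.toKIdx → IBondY x.toKIdx}
    (Gp : ∀ x : MemberY d ℓ hd hL b₀ b₁ Mstar, SiteOpY (Matrix (Fin N) (Fin N) ℂ) x.toKIdx)
    (parS : ∀ x : MemberY d ℓ hd hL b₀ b₁ Mstar, SiteParY (Matrix (Fin N) (Fin N) ℂ) x.toKIdx)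
    (h𝔭 : ∀ x : MemberY d ℓ hd hL b₀ b₁ Mstar,
      𝔭 x = holderProbesSN x.toKIdx (trBasis N) (bg9YR (Matrix (Fin N) (Fin N) ℂ) (specialUnitaryUnits (Fin N)) R₁ R₂ x) (fun U => U) (parS x) (bI x))
    (hblkS : ∀ x : MemberY d ℓ hd hL b₀ b₁ Mstar, (𝔬 x).blk = blkSK x.toKIdx (sIK x.toKIdx (bI x)))
    (hblkYS : ∀ x : MemberY d ℓ hd hL b₀ b₁ Mstar, (𝔬 x).blkY = blkSK x.toKIdx (sIK x.toKIdx (bI x)))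
    (hGpS : ∀ (x : MemberY d ℓ hd hL b₀ b₁ Mstar) U,
      (𝔬 x).Gp U = GcoS x.toKIdx (trBasis N) (bg9YR (Matrix (Fin N) (Fin N) ℂ) (specialUnitaryUnits (Fin N)) R₁ R₂ x) (fun U => U) (Gp x) U)
    (hDS : ∀ (x : MemberY d ℓ hd hL b₀ b₁ Mstar) U, (𝔬 x).D U = DcoS x.toKIdx (trBasis N) (bg9YR (Matrix (Fin N) (Fin N) ℂ) (specialUnitaryUnits (Fin N)) R₁ R₂ x) (fun U => U) U)
    (hDsS : ∀ (x : MemberY d ℓ hd hL b₀ b₁ Mstar) U,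
      (𝔬 x).Dstar U = DscoS x.toKIdx (trBasis N) (bg9YR (Matrix (Fin N) (Fin N) ℂ) (specialUnitaryUnits (Fin N)) R₁ R₂ x) (fun U => U) U)
    (h𝔡d : ∀ (x : MemberY d ℓ hd hL b₀ b₁ Mstar) (U : (bg9YR (Matrix (Fin N) (Fin N) ℂ) (specialUnitaryUnits (Fin N)) R₁ R₂ x).Cfg),
      (𝔡 x).Dd U = fun μ => (etaS x.toKIdx)⁻¹ • coordOpK (trBasis N) (fun _ : Fin (d + 1) => (cdSL x.toKIdx U μ).restrictScalars ℝ))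
    (h𝔡s : ∀ (x : MemberY d ℓ hd hL b₀ b₁ Mstar) (U : (bg9YR (Matrix (Fin N) (Fin N) ℂ) (specialUnitaryUnits (Fin N)) R₁ R₂ x).Cfg),
      (𝔡 x).Dsd U = fun μ => (etaS x.toKIdx)⁻¹ • coordOpK (trBasis N) (fun _ : Fin (d + 1) => (cdsSL x.toKIdx U μ).restrictScalars ℝ))
    (hGsqF : ∀ (x : MemberY d ℓ hd hL b₀ b₁ Mstar) (U : (bg9YR (Matrix (Fin N) (Fin N) ℂ) (specialUnitaryUnits (Fin N)) R₁ R₂ x).Cfg)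
      (c : ↥(cubes x.toKIdx.D.toDomains)),
      (𝔬 x).Gsq U c = gsqcoS x (trBasis N) (bg9YR (Matrix (Fin N) (Fin N) ℂ) (specialUnitaryUnits (Fin N)) R₁ R₂ x) (fun U => U) (parSymY x.toKIdx) c U)
    {M₁ a₁ c R : ℝ} {H : MemberY d ℓ hd hL b₀ b₁ Mstar → Prop}
    {P₁ P₂ P₃ P₄ P₄' P₅ P₆ P₇ P₈ : ∀ x : MemberY d ℓ hd hL b₀ b₁ Mstar, (bg9YR (Matrix (Fin N) (Fin N) ℂ) (specialUnitaryUnits (Fin N)) R₁ R₂ x).Cfg → Prop}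
    -- RULING-2 (c): node00-def-Y's `dirTranspose37_memberY` reads the (3.35) class of `U` — ONE displayed class-content hypothesis: the R-class lies in MODULE 3's class at the same constant
    (hY335 : ∀ (x : MemberY d ℓ hd hL b₀ b₁ Mstar) (α₀ : ℝ) (U : (bg9YR (Matrix (Fin N) (Fin N) ℂ) (specialUnitaryUnits (Fin N)) R₁ R₂ x).Cfg), (bg9YR (Matrix (Fin N) (Fin N) ℂ) (specialUnitaryUnits (Fin N)) R₁ R₂ x).Reg335 c α₀ U → (bg9Y (Matrix (Fin N) (Fin N) ℂ) (specialUnitaryUnits (Fin N)) x).Reg335 c α₀ U)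
    (h36H : ∀ x : MemberY d ℓ hd hL b₀ b₁ Mstar, M₁ ≤ (geo9Y x).M → ∀ α₀ : ℝ, 0 < α₀ → c * (geo9Y x).M * α₀ ≤ a₁ →
      ∀ U : (bg9YR (Matrix (Fin N) (Fin N) ℂ) (specialUnitaryUnits (Fin N)) R₁ R₂ x).Cfg, (bg9YR (Matrix (Fin N) (Fin N) ℂ) (specialUnitaryUnits (Fin N)) R₁ R₂ x).Reg335 c α₀ U →
        P₁ x U ∧ P₂ x U ∧ (P₃ x U ∧ P₄ x U ∧ P₄' x U) ∧ (P₅ x U ∧ P₆ x U) ∧ (P₇ x U ∧ P₈ x U)) :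
    ∀ x : MemberY d ℓ hd hL b₀ b₁ Mstar, M₁ ≤ (geo9Y x).M → ∀ α₀ : ℝ, 0 < α₀ → c * (geo9Y x).M * α₀ ≤ a₁ →
      ∀ U : (bg9YR (Matrix (Fin N) (Fin N) ℂ) (specialUnitaryUnits (Fin N)) R₁ R₂ x).Cfg, (bg9YR (Matrix (Fin N) (Fin N) ℂ) (specialUnitaryUnits (Fin N)) R₁ R₂ x).Reg335 c α₀ U →
        P₁ x U ∧ P₂ x U ∧ (P₃ x U ∧ (∀ q', IsTransposePair ((𝔬 x).Gsq U q') ((𝔬 x).Gsq U q')) ∧ P₄ x U ∧ P₄' x U ∧ DirTranspose37 (𝔬 x) (𝔡 x) U) ∧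
          (P₅ x U ∧ P₆ x U ∧ DirSupHolder37 (𝔬 x) (𝔡 x) (𝔭 x) R (H x) U) ∧ (P₇ x U ∧ P₈ x U ∧ DirSup37 (𝔬 x) (𝔡 x) R (H x) U) :=
  fun x hM α₀ hα₀ ha U hU => by
  obtain ⟨h₁, h₂, ⟨h₃, h₄, h₄'⟩, ⟨h₅, h₆⟩, ⟨h₇, h₈⟩⟩ := h36H x hM α₀ hα₀ ha U hU
  have hT : ∀ q', IsTransposePair ((𝔬 x).Gsq U q') ((𝔬 x).Gsq U q') := fun q' => by
    rw [hGsqF x U q']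
    exact isTransposePair_GcoS_trBasis x.toKIdx (bg9YR (Matrix (Fin N) (Fin N) ℂ) (specialUnitaryUnits (Fin N)) R₁ R₂ x) (fun U => U)
      (GsqY x.toKIdx (parSymY x.toKIdx) (cubeDomY x q')) U
      (isSymmTr_GsqY_parSymY x.toKIdx specialUnitaryUnits_le_unitaryUnits (mem_of_reg335R hGR x hU) (cubeDomY x q'))
  -- the three Ops-typed Y-faces consumed UNCHANGED at the fieldwise re-typings `opsRY ∕ dirOps37RY ∕ holderProbesRY` (`B9OpsRTransport`), outputs carried back by the bridges
  have hTr : DirTranspose37 (𝔬 x) (𝔡 x) U := by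
    simpa only [dirTranspose37_iff] using dirTranspose37_memberY x (opsRY (𝔬 x)) (dirOps37RY (𝔡 x)) U (hY335 x α₀ U hU) (h𝔡d x U) (h𝔡s x U)
  -- dag-n06-c's B-generic near-pair face: no `opsRY` transport needed for this conjunct
  have hSH : DirSupHolder37 (𝔬 x) (𝔡 x) (𝔭 x) R (H x) U :=
    dirSupHolder37_pinsSN x (trBasis N) (bg9YR (Matrix (Fin N) (Fin N) ℂ) (specialUnitaryUnits (Fin N)) R₁ R₂ x) (fun U => U) (Gp x) (𝔬 x) (𝔡 x) (𝔭 x)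
      (parS x) (h𝔭 x) (hblkS x) (hGpS x U) (hDS x U) (h𝔡d x U)
  have hS : DirSup37 (𝔬 x) (𝔡 x) R (H x) U := by
    simpa only [dirSup37_iff] using dirSup37_pins x (opsRY (𝔬 x)) (dirOps37RY (𝔡 x)) (Gp x) (hblkS x) (hblkYS x) (hGpS x U) (hDS x U) (hDsS x U) (h𝔡d x U) (h𝔡s x U)
  exact ⟨h₁, h₂, ⟨h₃, hT, h₄, h₄', hTr⟩, ⟨h₅, h₆, hSH⟩, ⟨h₇, h₈, hS⟩⟩

end Summit.QuantumFields.YangMills.BalabanUVNodes.N06DirKinematics3AtPinsSN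

end
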